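import Summits.Ventures.LatticeQCDFlow.Scaling.TaggedCostSideDeepTwo

/-!
HONEST FRAMING: exact (Metropolis-corrected) sampling algorithms for lattice gauge theory; figures
of merit are autocorrelation/cost numbers at stated couplings and volumes; no continuum-physics
claim.

# TaggedResidualIncome — THE INCOME DATA OF THE RESIDUAL PAIR (HUB CONTENT ALONE, EVERY OTHER PRESENT CONTENT STRICTLY BELOW IT): THE SCALAR INEQUALITY AGAINST GEN-41 FILE 6 (B)'S
# BUDGET, THE HUB ROW, THE SLACK AT ★ AND `θ_z − θ_a ≥ (1−α)(1−θ_a)/(1+α)` (lean-2 GEN-42, ours)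

Venture-side (OURS).  Cell `lqcd-flow` (pub-lqcd), unit `pub-lqcd-lean-2-g42`, 2026-08-30.  Chapter AB (route (β), the cost side continued), file 7a — the lemmas of file 7b
(`TaggedCostSideResidual`), split off for the 400-line rule.  Configuration (B) of GEN-41 file 6 (`N_C(z) = 1`, `W_w < W_z` for every other present `w`, `W_z ≤ W_b ≤ W_a`,
`W_z < W_a`); `α = W_z/W_a`:

* §1 `costSide_scalar_residual`: for `K ≥ 2`, `α, σ ∈ [0,1]`, `θ_a ≥ ½`, `L ≤ 4K+2`,
  `L·(α/(1+α))(1/K)(σ/K)/(1−(σ/K)²) ≤ 2[α(K−2+3θ_a)/K + σ(α/K)(1−α)(1−θ_a)/(1+α)]/((1−σ/K)(1+σα/K))` — after clearing denominators and `θ_a ≥ ½`: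
  `K(K+σ)[(2K−1)(1+α) + σ(1−α)] − (4K+2)σ(K+σα) ≥ (2K³−2K²−3K) + α(2K³−6K−2) ≥ 0` (toy `numerics42/configB_scalar.py`: ratio ≥ 1.2, attained at `K = 2`);
* §2 `costSide_residual_offsum` (`Σ_{v≠z}P_X(z,v) = (K−1)/K`), `costSide_residual_slack_none` (`slack(★) ≥ θ_z − θ_a`: every present content lies at or below `z`),
  `costSide_residual_theta` (`θ_z − θ_a ≥ (1−α)(1−θ_a)/(1+α)`, from `θ_z − θ_a = (1−α)θ_z(1−θ_a)` and `θ_z ≥ 1/(1+α)`);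
* §3 `costSide_scalar_loneBetween` (`K ≥ 3`): the same income against the residual budget PLUS the odd-attempt budget `((2α−1)⁺/2)c(σc)²/(1−σ²c²)` of the lone hub strictly
  between the extra particles (file 16): the odd part is at most `σ/K` times the even part, `1+σ/K` cancels `K+σ`, and `(4K+2)σ(K+σα) ≤ K²[(2K−1)(1+α)+σ(1−α)]` for `K ≥ 3`.

Literature grade (cell rule): OWN; nothing cited; no new bib keys.
-/

open Finset

namespace Summit.Ventures.LatticeQCDFlow.Scaling

/-! ### §1 The scalar inequality -/
section ResidualScalar

/-- **The scalar inequality of the residual pair:** for `K ≥ 2`, `α, σ ∈ [0,1]`, `θ_a ≥ ½`, `L ≤ 4K+2`: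
`L·(α/(1+α))(1/K)(σ/K)/(1−(σ/K)²) ≤ 2·[α(K−2+3θ_a)/K + σ(α/K)(1−α)(1−θ_a)/(1+α)]/((1−σ/K)(1+σα/K))`. [ours] -/
theorem costSide_scalar_residual {K L α θa σ : ℝ} (hK : 2 ≤ K) (hL : L ≤ 4 * K + 2) (hα0 : 0 ≤ α) (hα1 : α ≤ 1)
    (hθ : 1 / 2 ≤ θa) (hσ0 : 0 ≤ σ) (hσ1 : σ ≤ 1) :
    L * ((α / (1 + α)) * (1 / K) * (σ * (1 / K) / (1 - (σ * (1 / K)) ^ 2)))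
      ≤ 2 * ((α * (K - 2 + 3 * θa) / K + σ * (α / K) * ((1 - α) * (1 - θa) / (1 + α))) / ((1 - σ / K) * (1 + σ * α / K))) := by
  have hK0 : 0 < K := by linarith
  have hσK : σ / K ≤ 1 / 2 := by rw [div_le_iff₀ hK0]; linarith
  have h1 : 0 < 1 - σ / K := by linarith
  have hσα0 : 0 ≤ σ * α := mul_nonneg hσ0 hα0
  have hσαK : 0 ≤ σ * α / K := div_nonneg hσα0 hK0.le
  have h2 : 0 < 1 + σ * α / K := by linarith
  have h3 : 0 < 1 + α := by linarith
  have hKσ : 0 < K - σ := by linarith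
  have hKσ' : 0 < K + σ := by linarith
  have hKσα : 0 < K + σ * α := by linarith
  have hKne := hK0.ne'
  have hKσne := hKσ.ne'
  have hKσne' := hKσ'.ne'
  have hKσαne := hKσα.ne'
  have h3ne := h3.ne'
  -- rewrite both sides as single fractions
  have hden1 : 1 - (σ * (1 / K)) ^ 2 = (K - σ) * (K + σ) / K ^ 2 := by field_simp; ring
  have hden2 : (1 - σ / K) * (1 + σ * α / K) = (K - σ) * (K + σ * α) / K ^ 2 := by field_simp
  have eL : L * ((α / (1 + α)) * (1 / K) * (σ * (1 / K) / (1 - (σ * (1 / K)) ^ 2))) = L * α * σ / ((1 + α) * (K - σ) * (K + σ)) := by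
    rw [hden1, div_div_eq_mul_div]
    field_simp
  have eR : 2 * ((α * (K - 2 + 3 * θa) / K + σ * (α / K) * ((1 - α) * (1 - θa) / (1 + α))) / ((1 - σ / K) * (1 + σ * α / K)))
      = 2 * K * α * ((K - 2 + 3 * θa) * (1 + α) + σ * (1 - α) * (1 - θa)) / ((1 + α) * (K - σ) * (K + σ * α)) := by
    rw [hden2, div_div_eq_mul_div, eq_div_iff (by positivity)]
    field_simp
  rw [eL, eR, div_le_div_iff₀ (by positivity) (by positivity)]
  -- the polynomial inequality `G ≥ 0` (times `α(1+α)(K−σ) ≥ 0`), with `L ≤ 4K+2` and `θ_a ≥ ½`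
  have hG : (4 * K + 2) * σ * (K + σ * α) ≤ K * ((2 * K - 1) * (1 + α) + σ * (1 - α)) * (K + σ) := by
    have hKα : (K - 1) * α ≤ K - 1 := mul_le_of_le_one_right (by linarith) hα1
    have t1 : 0 ≤ (1 - σ) * (K * ((K + 3) - (K - 1) * α)) := mul_nonneg (by linarith) (mul_nonneg hK0.le (by linarith))
    have hσ2 : σ ^ 2 ≤ 1 := by rw [pow_two]; exact mul_le_one₀ hσ1 hσ0 hσ1
    have t2 : 0 ≤ (1 - σ ^ 2) * ((5 * K + 2) * α) := mul_nonneg (by linarith) (mul_nonneg (by linarith) hα0)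
    have t3 : 0 ≤ K * σ ^ 2 := mul_nonneg hK0.le (sq_nonneg σ)
    have hK2' : 0 ≤ K - 2 := by linarith
    have t4 : 0 ≤ 2 * K ^ 3 - 2 * K ^ 2 - 3 * K := by
      have h' : 0 ≤ 2 * (K - 2) * (K + 1) := mul_nonneg (mul_nonneg (by norm_num) hK2') (by linarith)
      have e : 2 * K ^ 3 - 2 * K ^ 2 - 3 * K = K * (2 * (K - 2) * (K + 1) + 1) := by ring
      rw [e]; exact mul_nonneg hK0.le (by linarith)
    have t5 : 0 ≤ α * (2 * K ^ 3 - 6 * K - 2) := by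
      refine mul_nonneg hα0 ?_
      have h' : 0 ≤ 2 * (K - 2) * (K + 1) ^ 2 := mul_nonneg (mul_nonneg (by norm_num) hK2') (sq_nonneg _)
      have e : 2 * K ^ 3 - 6 * K - 2 = 2 * (K - 2) * (K + 1) ^ 2 + 2 := by ring
      rw [e]; linarith
    linarith [t1, t2, t3, t4, t5]
  -- `L·ασ(K+σα)·[(1+α)(K−σ)] ≤ 2Kα[…](K+σ)·[(1+α)(K−σ)]`
  have hθpart : K * ((2 * K - 1) * (1 + α) + σ * (1 - α)) ≤ 2 * K * ((K - 2 + 3 * θa) * (1 + α) + σ * (1 - α) * (1 - θa)) + 0 := by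
    -- increasing in `θ_a`; at `θ_a = ½` the two sides agree
    have hσα' : σ * (1 - α) ≤ 1 := mul_le_one₀ hσ1 (by linarith) (by linarith)
    have hin : 0 ≤ 3 * (1 + α) - σ * (1 - α) := by linarith
    have hcoef : 0 ≤ 2 * K * (3 * (1 + α) - σ * (1 - α)) := mul_nonneg (by linarith) hin
    linarith [mul_nonneg hcoef (by linarith : (0:ℝ) ≤ θa - 1 / 2)]
  have hcommon : 0 ≤ α * ((1 + α) * (K - σ)) := by positivity
  have hLσ : L * α * σ * ((1 + α) * (K - σ) * (K + σ * α)) ≤ (4 * K + 2) * α * σ * ((1 + α) * (K - σ) * (K + σ * α)) := by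
    have h0 : 0 ≤ α * σ * ((1 + α) * (K - σ) * (K + σ * α)) := by positivity
    calc L * α * σ * ((1 + α) * (K - σ) * (K + σ * α)) = L * (α * σ * ((1 + α) * (K - σ) * (K + σ * α))) := by ring
      _ ≤ (4 * K + 2) * (α * σ * ((1 + α) * (K - σ) * (K + σ * α))) := mul_le_mul_of_nonneg_right hL h0
      _ = (4 * K + 2) * α * σ * ((1 + α) * (K - σ) * (K + σ * α)) := by ring
  calc L * α * σ * ((1 + α) * (K - σ) * (K + σ * α)) ≤ (4 * K + 2) * α * σ * ((1 + α) * (K - σ) * (K + σ * α)) := hLσ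
    _ = ((4 * K + 2) * σ * (K + σ * α)) * (α * ((1 + α) * (K - σ))) := by ring
    _ ≤ (K * ((2 * K - 1) * (1 + α) + σ * (1 - α)) * (K + σ)) * (α * ((1 + α) * (K - σ))) := mul_le_mul_of_nonneg_right hG hcommon
    _ ≤ (2 * K * ((K - 2 + 3 * θa) * (1 + α) + σ * (1 - α) * (1 - θa)) * (K + σ)) * (α * ((1 + α) * (K - σ))) := by
        apply mul_le_mul_of_nonneg_right _ hcommon
        exact mul_le_mul_of_nonneg_right (by linarith [hθpart]) hKσ'.le
    _ = 2 * K * α * ((K - 2 + 3 * θa) * (1 + α) + σ * (1 - α) * (1 - θa)) * ((1 + α) * (K - σ) * (K + σ)) := by ring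

end ResidualScalar

/-! ### §2 The kernel data of the residual pair -/
section ResidualKernel
variable {S : Type*} [Fintype S] [DecidableEq S]
variable {W θ : S → ℝ} {acc : S → S → ℝ} {p : ℝ} {K : ℕ} {NC : S → ℕ} {a : S} {PX : Option S → Option S → ℝ}

/-- **From the hub of the residual pair the off-diagonal ordinary row mass is `(K−1)/K`** (every other present content lies strictly below `z`, `N_C(z) = 1`). [ours] -/
theorem costSide_residual_offsum (hW : ∀ v, 0 < W v) (hacc : ∀ h v, acc h v = min 1 (W h / W v)) (hK : 1 ≤ K) (hNC : ∑ v, NC v = K)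
    (hPXoff : ∀ h v, h ≠ v → PX (some h) (some v) = if NC h = 0 then 0 else (NC v : ℝ) / K * acc h v)
    {z : S} (hz1 : NC z = 1) (hbelow : ∀ w, w ≠ z → NC w ≠ 0 → W w < W z) :
    ∑ v ∈ univ.erase z, PX (some z) (some v) = ((K : ℝ) - 1) / K := by
  have hz : NC z ≠ 0 := by rw [hz1]; exact one_ne_zero
  have hK0 : (0 : ℝ) < K := by exact_mod_cast hK
  have hterm : ∀ v ∈ univ.erase z, PX (some z) (some v) = (NC v : ℝ) / K := by
    intro v hv
    have hvz : v ≠ z := ne_of_mem_erase hv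
    rw [hPXoff z v hvz.symm, if_neg hz]
    by_cases hNv : NC v = 0
    · rw [hNv]; simp
    · have hacc1 : acc z v = 1 := by
        rw [hacc]; exact min_eq_left ((one_le_div (hW v)).mpr (hbelow v hvz hNv).le)
      rw [hacc1, mul_one]
  rw [sum_congr rfl hterm, ← sum_div]
  have h := add_sum_erase univ (fun v => (NC v : ℝ)) (mem_univ z)
  have htot : ∑ v, (NC v : ℝ) = K := by exact_mod_cast hNC
  rw [htot, hz1] at h
  push_cast at h
  congr 1
  linarith

omit [DecidableEq S] in
/-- **The slack at ★ for the residual pair:** `slack(★) ≥ θ_z − θ_a` (every present content lies at or below `z`, hence costs at most `1 − θ_z` to displace). [ours] -/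
theorem costSide_residual_slack_none (hW : ∀ v, 0 < W v) (hp0 : 0 ≤ p) (hp : ∀ v, p * W v ≤ 1) (hθ : ∀ v, θ v = 1 / (1 + p * W v))
    (hacc : ∀ h v, acc h v = min 1 (W h / W v))
    (hPXout : ∀ v, PX none (some v) = (NC v : ℝ) / K * acc a v) (hPXstay : PX none none = 1 - ∑ v, PX none (some v))
    (hK : 2 ≤ K) (hNC : ∑ v, NC v = K) {M : ℝ} (hM : M = ∑ v, θ v * (NC v : ℝ) + θ a)
    {r Λ sl : Option S → ℝ} (hrn : r none = (K + M) - (1 - θ a)) (hrs : ∀ v, r (some v) = -(1 - θ v))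
    (hΛn : Λ none = -(1 - θ a)) (hΛs : ∀ v, Λ (some v) = 0) (hsl : ∀ t, sl t = ∑ t', PX t t' * (r t' + Λ t') - Λ t)
    {z : S} (hle : ∀ w, NC w ≠ 0 → W w ≤ W z) : θ z - θ a ≤ sl none := by
  have hθm := theta_mem hW hp0 hp hθ
  have hK1 : 1 ≤ K := by omega
  have hK0 : (0 : ℝ) < K := by exact_mod_cast hK1
  have hK2 : (2 : ℝ) ≤ K := by exact_mod_cast hK
  rw [hsl, tagged_sum_option, hrn, hΛn, hPXstay]
  simp_rw [hrs, hΛs, add_zero]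
  -- the exit cost `Σ_v P(★,v)(1−θ_v) ≤ (1−θ_z)·Σ_v N_C(v)/K = 1−θ_z`
  have hterm : ∀ v, PX none (some v) * (1 - θ v) ≤ (NC v : ℝ) / K * (1 - θ z) := by
    intro v
    rw [hPXout]
    by_cases hNv : NC v = 0
    · rw [hNv]; simp
    · have hWv := hle v hNv
      have hacc1 : acc a v ≤ 1 := by rw [hacc]; exact min_le_left _ _
      have hacc0 : 0 ≤ acc a v := starHub_acc_nonneg hW hacc a v
      -- `θ_v ≥ θ_z` since `W_v ≤ W_z`
      have hθvz : θ z ≤ θ v := by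
        rw [hθ, hθ]
        apply one_div_le_one_div_of_le (by nlinarith [mul_nonneg hp0 (hW v).le])
        nlinarith [mul_le_mul_of_nonneg_left hWv hp0]
      have hNK : 0 ≤ (NC v : ℝ) / K := div_nonneg (Nat.cast_nonneg _) hK0.le
      have h1 : 0 ≤ 1 - θ v := by linarith [(hθm v).2]
      calc (NC v : ℝ) / K * acc a v * (1 - θ v) ≤ (NC v : ℝ) / K * 1 * (1 - θ v) :=
            mul_le_mul_of_nonneg_right (mul_le_mul_of_nonneg_left hacc1 hNK) h1
        _ ≤ (NC v : ℝ) / K * (1 - θ z) := by rw [mul_one]; exact mul_le_mul_of_nonneg_left (by linarith) hNK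
  have hcost : ∑ v, PX none (some v) * (1 - θ v) ≤ 1 - θ z := by
    calc ∑ v, PX none (some v) * (1 - θ v) ≤ ∑ v, (NC v : ℝ) / K * (1 - θ z) := sum_le_sum fun v _ => hterm v
      _ = (∑ v, (NC v : ℝ)) / K * (1 - θ z) := by rw [sum_div, sum_mul]
      _ = 1 - θ z := by rw [show ∑ v, (NC v : ℝ) = K by exact_mod_cast hNC, div_self hK0.ne', one_mul]
  have hneg : ∑ v, PX none (some v) * -(1 - θ v) = -∑ v, PX none (some v) * (1 - θ v) := by
    rw [← sum_neg_distrib]; exact sum_congr rfl fun v _ => by ring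
  rw [hneg]
  -- the holding term is non-negative
  have hP0 : 0 ≤ 1 - ∑ v, PX none (some v) := by linarith [tagged_outRow_le hacc hPXout hK1 hNC (s := a)]
  have hMθ : 0 ≤ M := by
    rw [hM]; exact add_nonneg (sum_nonneg fun v _ => mul_nonneg (by linarith [(hθm v).1]) (Nat.cast_nonneg _)) (by linarith [(hθm a).1])
  have hR : 0 ≤ (K : ℝ) + M - (1 - θ a) + -(1 - θ a) := by linarith [(hθm a).1]
  nlinarith [mul_nonneg hP0 hR]

omit [Fintype S] [DecidableEq S] in
/-- **`θ_z − θ_a ≥ (1 − α)(1 − θ_a)/(1 + α)`**, `α = W_z/W_a ≤ 1` (`θ_z − θ_a = θ_z(1−θ_a)(1−α)`, `θ_z ≥ 1/(1+α)` since `pW_a ≤ 1`). [ours] -/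
theorem costSide_residual_theta (hW : ∀ v, 0 < W v) (hp0 : 0 ≤ p) (hp : ∀ v, p * W v ≤ 1) (hθ : ∀ v, θ v = 1 / (1 + p * W v))
    {z a : S} (hza : W z ≤ W a) : (1 - W z / W a) * (1 - θ a) / (1 + W z / W a) ≤ θ z - θ a := by
  have hWa := hW a; have hWz := hW z
  set α := W z / W a with hα
  have hα0 : 0 ≤ α := div_nonneg hWz.le hWa.le
  have hα1 : α ≤ 1 := (div_le_one hWa).mpr hza
  have hWzα : W z = α * W a := by rw [hα]; field_simp
  have hpa0 : 0 ≤ p * W a := mul_nonneg hp0 hWa.le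
  have hu : p * W a ≤ 1 := hp a
  have hda : 0 < 1 + p * W a := by linarith
  have hdz : 0 < 1 + p * (α * W a) := by nlinarith [mul_nonneg hpa0 hα0]
  have eθa : θ a = 1 / (1 + p * W a) := hθ a
  have eθz : θ z = 1 / (1 + p * (α * W a)) := by rw [hθ z, hWzα]
  -- `θ_z − θ_a = (1−α)·θ_z·(1−θ_a)` and `θ_z ≥ 1/(1+α)`
  have hid : θ z - θ a = (1 - α) * θ z * (1 - θ a) := by
    rw [eθa, eθz]
    field_simp
    ring
  have hθz : 1 / (1 + α) ≤ θ z := by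
    rw [eθz]
    apply one_div_le_one_div_of_le hdz
    nlinarith [mul_le_mul_of_nonneg_right hu hα0]
  have hθa1 : 0 ≤ 1 - θ a := by
    rw [eθa, sub_nonneg, div_le_one hda]; linarith
  have hc : 0 ≤ (1 - α) * (1 - θ a) := mul_nonneg (by linarith) hθa1
  rw [hid]
  calc (1 - α) * (1 - θ a) / (1 + α) = (1 - α) * (1 - θ a) * (1 / (1 + α)) := by ring
    _ ≤ (1 - α) * (1 - θ a) * θ z := mul_le_mul_of_nonneg_left hθz hc
    _ = (1 - α) * θ z * (1 - θ a) := by ring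

end ResidualKernel

/-! ### §3 The scalar inequality of the lone hub strictly between (`K ≥ 3`; consumed by file 16) -/
section LoneScalar

set_option maxHeartbeats 400000 in
/-- **The scalar inequality of the lone hub between, `K ≥ 3`:** the residual (even-attempt) budget plus the hub-above (odd-attempt) budget `((2α−1)⁺/2)·c(σc)²/(1−(σc)²)` is at most the
residual income; the odd part is at most `σ/K` times the even part, `(1+σ/K)` cancels `(K+σ)`, and `(4K+2)σ(K+σα) ≤ K²[(2K−1)(1+α) + σ(1−α)]` for `K ≥ 3`
(`≥ (2K³−4K²−2K) + α(2K³−2K²−4K−2)`; false at `K = 2`, `α = σ = 1`). [ours] -/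
theorem costSide_scalar_loneBetween {K L α θa σ : ℝ} (hK : 3 ≤ K) (hL : L ≤ 4 * K + 2) (hL0 : 0 ≤ L) (hα0 : 0 ≤ α) (hα1 : α ≤ 1)
    (hθ : 1 / 2 ≤ θa) (hσ0 : 0 ≤ σ) (hσ1 : σ ≤ 1) :
    L * ((α / (1 + α)) * (1 / K) * (σ * (1 / K) / (1 - (σ * (1 / K)) ^ 2))
        + (max 0 (2 * α - 1) / 2) * (1 / K) * ((σ * (1 / K)) ^ 2 / (1 - (σ * (1 / K)) ^ 2)))
      ≤ 2 * ((α * (K - 2 + 3 * θa) / K + σ * (α / K) * ((1 - α) * (1 - θa) / (1 + α))) / ((1 - σ / K) * (1 + σ * α / K))) := by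
  have hK0 : 0 < K := by linarith
  have hKne := hK0.ne'
  have hσK : σ / K ≤ 1 / 3 := by rw [div_le_iff₀ hK0]; linarith
  have h1 : 0 < 1 - σ / K := by linarith
  have hσα0 : 0 ≤ σ * α := mul_nonneg hσ0 hα0
  have hσαK : 0 ≤ σ * α / K := div_nonneg hσα0 hK0.le
  have h2 : 0 < 1 + σ * α / K := by linarith
  have h3 : 0 < 1 + α := by linarith
  have h3ne := h3.ne'
  have hKσ : 0 < K - σ := by linarith
  have hKσne := hKσ.ne'
  have hKσ' : 0 < K + σ := by linarith
  have hKσne' := hKσ'.ne'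
  have hKσα : 0 < K + σ * α := by linarith
  have hKσαne := hKσα.ne'
  -- the two budget terms as single fractions
  have hden1 : 1 - (σ * (1 / K)) ^ 2 = (K - σ) * (K + σ) / K ^ 2 := by field_simp; ring
  have hD0 : 0 < 1 - (σ * (1 / K)) ^ 2 := by rw [hden1]; positivity
  set first := (α / (1 + α)) * (1 / K) * (σ * (1 / K) / (1 - (σ * (1 / K)) ^ 2)) with hfirst
  set second := (max 0 (2 * α - 1) / 2) * (1 / K) * ((σ * (1 / K)) ^ 2 / (1 - (σ * (1 / K)) ^ 2)) with hsecond
  have hfirst0 : 0 ≤ first := by rw [hfirst]; positivity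
  -- `second ≤ (σ/K)·first`: `(2α−1)⁺(1+α) ≤ 2α`
  have hm : max 0 (2 * α - 1) * (1 + α) ≤ 2 * α := by
    rcases le_total 0 (2 * α - 1) with h | h
    · rw [max_eq_right h]; nlinarith
    · rw [max_eq_left h]; linarith
  have hsec : second ≤ σ / K * first := by
    rw [hsecond, hfirst]
    have e1 : max 0 (2 * α - 1) / 2 * (1 / K) * ((σ * (1 / K)) ^ 2 / (1 - (σ * (1 / K)) ^ 2))
        = (max 0 (2 * α - 1) * (1 + α)) * (σ / K * (1 / (1 + α) * (1 / K) * (σ * (1 / K) / (1 - (σ * (1 / K)) ^ 2)))) / 2 := by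
      field_simp
    have e2 : σ / K * (α / (1 + α) * (1 / K) * (σ * (1 / K) / (1 - (σ * (1 / K)) ^ 2)))
        = (2 * α) * (σ / K * (1 / (1 + α) * (1 / K) * (σ * (1 / K) / (1 - (σ * (1 / K)) ^ 2)))) / 2 := by
      field_simp
    have hpos : 0 ≤ σ / K * (1 / (1 + α) * (1 / K) * (σ * (1 / K) / (1 - (σ * (1 / K)) ^ 2))) := by positivity
    rw [e1, e2]
    exact div_le_div_of_nonneg_right (mul_le_mul_of_nonneg_right hm hpos) (by norm_num)
  -- so the left side is at most `L(1+σ/K)·first = Lασ/(K(1+α)(K−σ))`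
  have hLHS : L * (first + second) ≤ L * ((1 + σ / K) * first) := by
    apply mul_le_mul_of_nonneg_left _ hL0
    have : (1 + σ / K) * first = first + σ / K * first := by ring
    rw [this]; linarith
  have eL : L * ((1 + σ / K) * first) = L * α * σ / (K * ((1 + α) * (K - σ))) := by
    rw [hfirst, hden1, div_div_eq_mul_div]
    field_simp
  have hden2 : (1 - σ / K) * (1 + σ * α / K) = (K - σ) * (K + σ * α) / K ^ 2 := by field_simp
  have eR : 2 * ((α * (K - 2 + 3 * θa) / K + σ * (α / K) * ((1 - α) * (1 - θa) / (1 + α))) / ((1 - σ / K) * (1 + σ * α / K)))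
      = 2 * K * α * ((K - 2 + 3 * θa) * (1 + α) + σ * (1 - α) * (1 - θa)) / ((1 + α) * (K - σ) * (K + σ * α)) := by
    rw [hden2, div_div_eq_mul_div, eq_div_iff (by positivity)]
    field_simp
  refine hLHS.trans ?_
  rw [eL, eR, div_le_div_iff₀ (by positivity) (by positivity)]
  -- the polynomial inequality `(4K+2)σ(K+σα) ≤ K²[(2K−1)(1+α) + σ(1−α)]` for `K ≥ 3`
  have hH : (4 * K + 2) * σ * (K + σ * α) ≤ K ^ 2 * ((2 * K - 1) * (1 + α) + σ * (1 - α)) := by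
    have hK3 : 0 ≤ K - 3 := by linarith
    have t1 : 0 ≤ (1 - σ) * ((4 * K + 2) * K - K ^ 2 * (1 - α)) := mul_nonneg (by linarith) (by nlinarith)
    have hσ2 : σ ^ 2 ≤ 1 := by rw [pow_two]; exact mul_le_one₀ hσ1 hσ0 hσ1
    have t2 : 0 ≤ (1 - σ ^ 2) * ((4 * K + 2) * α) := mul_nonneg (by linarith) (mul_nonneg (by linarith) hα0)
    have t3 : 0 ≤ 2 * K ^ 3 - 4 * K ^ 2 - 2 * K := by
      have h' : 0 ≤ (K - 3) * (K + 1) := mul_nonneg hK3 (by linarith)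
      have e : 2 * K ^ 3 - 4 * K ^ 2 - 2 * K = 2 * K * ((K - 3) * (K + 1) + 2) := by ring
      rw [e]; exact mul_nonneg (by linarith) (by linarith)
    have t4 : 0 ≤ α * (2 * K ^ 3 - 2 * K ^ 2 - 4 * K - 2) := by
      refine mul_nonneg hα0 ?_
      have h' : 0 ≤ (K - 3) * (K ^ 2 + 2 * K + 4) := mul_nonneg hK3 (by positivity)
      have e : 2 * K ^ 3 - 2 * K ^ 2 - 4 * K - 2 = 2 * ((K - 3) * (K ^ 2 + 2 * K + 4) + 11) := by ring
      rw [e]; linarith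
    linarith [t1, t2, t3, t4]
  -- `θ_a ≥ ½` (monotone) and `L ≤ 4K+2`
  have hθpart : K ^ 2 * ((2 * K - 1) * (1 + α) + σ * (1 - α)) ≤ 2 * K ^ 2 * ((K - 2 + 3 * θa) * (1 + α) + σ * (1 - α) * (1 - θa)) := by
    have hσα' : σ * (1 - α) ≤ 1 := mul_le_one₀ hσ1 (by linarith) (by linarith)
    have hin : 0 ≤ 3 * (1 + α) - σ * (1 - α) := by linarith
    have hcoef : 0 ≤ 2 * K ^ 2 * (3 * (1 + α) - σ * (1 - α)) := mul_nonneg (by positivity) hin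
    linarith [mul_nonneg hcoef (by linarith : (0:ℝ) ≤ θa - 1 / 2)]
  have hcommon : 0 ≤ α * ((1 + α) * (K - σ)) := by positivity
  have hLσ : L * α * σ * ((1 + α) * (K - σ) * (K + σ * α)) ≤ (4 * K + 2) * α * σ * ((1 + α) * (K - σ) * (K + σ * α)) := by
    have h0 : 0 ≤ α * σ * ((1 + α) * (K - σ) * (K + σ * α)) := by positivity
    calc L * α * σ * ((1 + α) * (K - σ) * (K + σ * α)) = L * (α * σ * ((1 + α) * (K - σ) * (K + σ * α))) := by ring
      _ ≤ (4 * K + 2) * (α * σ * ((1 + α) * (K - σ) * (K + σ * α))) := mul_le_mul_of_nonneg_right hL h0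
      _ = (4 * K + 2) * α * σ * ((1 + α) * (K - σ) * (K + σ * α)) := by ring
  calc L * α * σ * ((1 + α) * (K - σ) * (K + σ * α)) ≤ (4 * K + 2) * α * σ * ((1 + α) * (K - σ) * (K + σ * α)) := hLσ
    _ = ((4 * K + 2) * σ * (K + σ * α)) * (α * ((1 + α) * (K - σ))) := by ring
    _ ≤ (K ^ 2 * ((2 * K - 1) * (1 + α) + σ * (1 - α))) * (α * ((1 + α) * (K - σ))) := mul_le_mul_of_nonneg_right hH hcommon
    _ ≤ (2 * K ^ 2 * ((K - 2 + 3 * θa) * (1 + α) + σ * (1 - α) * (1 - θa))) * (α * ((1 + α) * (K - σ))) := mul_le_mul_of_nonneg_right hθpart hcommon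
    _ = 2 * K * α * ((K - 2 + 3 * θa) * (1 + α) + σ * (1 - α) * (1 - θa)) * (K * ((1 + α) * (K - σ))) := by ring

end LoneScalar

end Summit.Ventures.LatticeQCDFlow.Scaling
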